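import Literature.NumberTheory.EllipticCurves.BSDSelmerSmithCaseVProofs
import HarnessLib

/-!
# Smith's cases in coordinates: `y² = x(x - r)(x - s)` (arXiv:2503.17619, Def. 1.6) — the
# balanced kernels are the square values among `rs`, `r(r - s)`, `s(s - r)`; the cases are inhabited

A `…Proofs` companion (theorems only, no new definitions, no named facts) of
`BSDSelmerSmithCases` (Smith's Def. 1.6: `Isogeny.IsBalanced`, `ratTwoTorsionCard`,
`smithCaseI`–`smithCaseV`) and `BSDSelmerSmithCaseVProofs`, making the case split **computable on
models with full rational `2`-torsion** and recording that the cases are **non-vacuous**: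

* §1 (any field, `char ≠ 2`) `E : y² = x(x - r)(x - s)` has `K(E[2]) = K`
  (`ker_galoisRepTorsion_two_eq_top_of_roots`, converse of
  `exists_roots_of_ker_galoisRepTorsion_two_eq_top`); kernels of degree-`2` isogenies on such
  `E` are `{O, (x₀, 0)}`, `x₀ ∈ {0, r, s}`.
* §2 (over `ℚ`) **A `2`-quotient `E → E/⟨(x₀, 0)⟩` (any isogeny with that kernel) is balanced iff
  `b + 2ax₀ + 3x₀²` is a square** (`Isogeny.isBalanced_iff_isSquare_of_ker_root`; "⟹" is
  `isSquare_of_isogeny_ker_root`, "⟸" makes the explicit quotient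
  `Y² = X³ - 2a'X² + (a'² - 4b')X` split); the three values are `rs`, `r(r - s)`, `s(s - r)`.
  This is the coordinate form of Smith's remark (§3, after Figure 1, from [Chil21]) that in the
  `2`-isogeny graph the curves with `E(ℚ)[2] ≅ (ℤ/2ℤ)²` are the vertices of degree `3`.
* §3 **Case V / Case IV / Case I (full `2`-torsion branch) for `y² = x(x - r)(x - s)`** hold iff
  at least two / exactly one / none of `rs`, `r(r - s)`, `s(s - r)` are squares
  (`smithCaseV_iff_of_roots`, `smithCaseIV_iff_of_roots`, `smithCaseI_iff_of_roots`); never all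
  three (`not_isSquare_three`). Examples: `y² = x(x - 25)(x - 9)` is in Case V,
  `y² = x(x - 1)(x - 4)` in Case IV, the congruent number curve `y² = x³ - x` in Case I,
  `y² = x³ + 4x` in Case III, `y² = x³ + 2x` in Case II (`smithCase…_example`) — all five cases
  of Def. 1.6 are inhabited. (For Case II, that `ℚ(√-2) ≠ ℚ(√8)`, i.e. the `2`-isogeny is not
  balanced, is shown without naming an element of `Γ_ℚ`: otherwise `√-2·√8` would be
  `Γ_ℚ`-fixed, i.e. `-16` a square in `ℚ`.)

## References

* [arXiv250317619] A. Smith, arXiv:2503.17619 (2025), §1.1 Def. 1.6; §3, Figure 1 and the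
  sentence after it.
* [ChiloyanLozanorobledo2021] G. Chiloyan, Á. Lozano-Robledo, Trans. London Math. Soc. 8 (2021),
  1–34, Thm. 1.2 (the `2`-isogeny graphs `T₄, T₆, T₈`).
* [SilvermanAEC2009] J. H. Silverman, *AEC*, 2nd ed., III.4 Example 4.5, X.4.9 (the `2`-isogenous
  curve and `2`-descent models).
-/

noncomputable section

open scoped Classical

universe u

namespace WeierstrassCurve

open Literature.NumberTheory.EllipticCurves

variable {K : Type u} [Field K]

/-! ## §1 `y² = x(x - r)(x - s)` has `K(E[2]) = K` -/

/-- **`E : y² = x(x - r)(x - s)` with `r, s ∈ K` has `K(E[2]) = K`** (`ker ρ̄_{E,2} = Γ_K`): its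
points of order dividing `2` are `O, (0,0), (r,0), (s,0)`, all `K`-rational. Converse of
`exists_roots_of_ker_galoisRepTorsion_two_eq_top`. Silverman, *AEC*, III.§7, VIII.§1. [folklore] -/
theorem ker_galoisRepTorsion_two_eq_top_of_roots (W : WeierstrassCurve K) [W.IsTwoTorsionNF]
    [W.IsElliptic] (h2 : (2 : K) ≠ 0) {r s : K} (h₂ : W.a₂ = -(r + s)) (h₄ : W.a₄ = r * s) :
    (W.galoisRepTorsion 2).ker = ⊤ := by
  have hr : r ^ 3 + W.a₂ * r ^ 2 + W.a₄ * r = 0 := by rw [h₂, h₄]; ring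
  have hs : s ^ 3 + W.a₂ * s ^ 2 + W.a₄ * s = 0 := by rw [h₂, h₄]; ring
  have h0 : (0 : K) ^ 3 + W.a₂ * 0 ^ 2 + W.a₄ * 0 = 0 := by ring
  rw [ker_galoisRepTorsion_eq_top_iff]
  intro σ P hP
  have hP' : (2 : ℕ) • P = 0 := by exact_mod_cast hP
  rcases geomPoints_eq_of_two_nsmul_eq_zero W h2 h₂ h₄ hP' with rfl | ⟨x, hx, rfl, hx0 | hxr | hxs⟩
  · exact smul_zero σ
  · rw [some_eq_toGeomPoints_of_eq W hx h0 (hx0.trans (map_zero _).symm)]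
    exact smul_toGeomPoints W σ _
  · rw [some_eq_toGeomPoints_of_eq W hx hr hxr]
    exact smul_toGeomPoints W σ _
  · rw [some_eq_toGeomPoints_of_eq W hx hs hxs]
    exact smul_toGeomPoints W σ _

/-- An isogeny with kernel `{O, T}`, `T ≠ O`, has degree `2`. [folklore] -/
theorem Isogeny.degree_eq_two_of_ker_pair {W W' : WeierstrassCurve K} (φ : Isogeny W W')
    {T : W.geomPoints} (hT : T ≠ 0) (h : ∀ Q, φ Q = 0 ↔ Q = 0 ∨ Q = T) : φ.degree = 2 := by
  unfold Isogeny.degree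
  have e : (φ.toAddMonoidHom.ker : Set W.geomPoints) = {0, T} := by
    ext Q
    rw [SetLike.mem_coe, AddMonoidHom.mem_ker, Isogeny.coe_toAddMonoidHom, h Q, Set.mem_insert_iff,
      Set.mem_singleton_iff]
  rw [← SetLike.coe_sort_coe, e, Nat.card_coe_set_eq, Set.ncard_pair hT.symm]

/-- A rational `2`-torsion point `(x₀, 0)` is not `O` in `E(K̄)`. [folklore] -/
theorem toGeomPoints_some_ne_zero (W : WeierstrassCurve K) {x₀ y₀ : K}
    (h : W.toAffine.Nonsingular x₀ y₀) : W.toGeomPoints (.some x₀ y₀ h) ≠ 0 := fun e ↦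
  Affine.Point.some_ne_zero h (toGeomPoints_injective W (e.trans (map_zero _).symm))

/-- **Kernels of degree-`2` isogenies on `y² = x(x - r)(x - s)`**: the kernel is `{O, (x₀, 0)}`
for `x₀ ∈ {0, r, s}`. [folklore] -/
theorem Isogeny.exists_root_of_degree_eq_two (W : WeierstrassCurve K) [W.IsTwoTorsionNF]
    [W.IsElliptic] (h2 : (2 : K) ≠ 0) {r s : K} (h₂ : W.a₂ = -(r + s)) (h₄ : W.a₄ = r * s)
    {E' : WeierstrassCurve K} (χ : Isogeny W E') (hχ : χ.degree = 2) :
    ∃ (x₀ : K) (hx₀ : x₀ ^ 3 + W.a₂ * x₀ ^ 2 + W.a₄ * x₀ = 0), (x₀ = 0 ∨ x₀ = r ∨ x₀ = s) ∧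
      ∀ Q, χ Q = 0 ↔ Q = 0 ∨ Q = W.toGeomPoints (.some x₀ 0 (nonsingular_of_root W hx₀)) := by
  have hr : r ^ 3 + W.a₂ * r ^ 2 + W.a₄ * r = 0 := by rw [h₂, h₄]; ring
  have hs : s ^ 3 + W.a₂ * s ^ 2 + W.a₄ * s = 0 := by rw [h₂, h₄]; ring
  have h0 : (0 : K) ^ 3 + W.a₂ * 0 ^ 2 + W.a₄ * 0 = 0 := by ring
  obtain ⟨T, hT0, hT2, hker⟩ := χ.exists_ker_eq_pair_of_degree_eq_two hχ
  rcases geomPoints_eq_of_two_nsmul_eq_zero W h2 h₂ h₄ hT2 with h | ⟨x, hx, rfl, hx0 | hxr | hxs⟩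
  · exact absurd h hT0
  · exact ⟨0, h0, Or.inl rfl, fun Q ↦ by
      rw [hker Q, some_eq_toGeomPoints_of_eq W hx h0 (hx0.trans (map_zero _).symm)]⟩
  · exact ⟨r, hr, Or.inr (Or.inl rfl), fun Q ↦ by rw [hker Q, some_eq_toGeomPoints_of_eq W hx hr hxr]⟩
  · exact ⟨s, hs, Or.inr (Or.inr rfl), fun Q ↦ by rw [hker Q, some_eq_toGeomPoints_of_eq W hx hs hxs]⟩

/-! ## §2 Over `ℚ`: which `2`-quotients are balanced -/

/-- `ℚ(E[2]) = ℚ` gives `#E(ℚ)[2] = 4`. [folklore] -/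
theorem ratTwoTorsionCard_eq_four_of_ker_eq_top (W : WeierstrassCurve ℚ) [W.IsElliptic]
    (h : (W.galoisRepTorsion 2).ker = ⊤) : ratTwoTorsionCard W = 4 := by
  unfold ratTwoTorsionCard
  have huniv : MulAction.fixedPoints (Field.absoluteGaloisGroup ℚ) (geomTorsion W (2 : ℤ)) =
      Set.univ := by
    ext P
    simp only [MulAction.mem_fixedPoints, Set.mem_univ, iff_true]
    intro σ
    exact Subtype.ext ((ker_galoisRepTorsion_eq_top_iff W 2).mp h σ P
      ((Submodule.mem_torsionBy_iff _ _).mp P.2))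
  rw [huniv, Nat.card_coe_set_eq, Set.ncard_univ, natCard_geomTorsion_two W]

/-- **The balanced `2`-quotients of `E : y² = x³ + ax² + bx` with `ℚ(E[2]) = ℚ`.** For such an
`E` (i.e. `x² + ax + b = (x - r)(x - s)` over `ℚ`) and an isogeny `χ : E → E'` over `ℚ` with
kernel `{O, (x₀, 0)}` (`x₀` a root of `x³ + ax² + bx`), `χ` is balanced iff
`b + 2ax₀ + 3x₀²` is a square in `ℚ` — i.e. iff the explicit quotient
`E/⟨(x₀,0)⟩ : Y² = X³ - 2a'X² + (a'² - 4b')X` (`b' = b + 2ax₀ + 3x₀²`) again has full rational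
`2`-torsion. For `E : y² = x(x - r)(x - s)` the three values of `b'` are `rs`, `r(r - s)`,
`s(s - r)`. Smith, arXiv:2503.17619, Def. 1.6 and §3 ("`E(ℚ)[2] = (ℤ/2ℤ)²` if and only if the
vertex corresponding to `E` has degree `3`"). [cite: arXiv250317619, Def. 1.6 and §3 (Figure 1)] -/
theorem Isogeny.isBalanced_iff_isSquare_of_ker_root (W : WeierstrassCurve ℚ) [W.IsTwoTorsionNF]
    [W.IsElliptic] {r s : ℚ} (h₂ : W.a₂ = -(r + s)) (h₄ : W.a₄ = r * s) {x₀ : ℚ}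
    (hx₀ : x₀ ^ 3 + W.a₂ * x₀ ^ 2 + W.a₄ * x₀ = 0) {E' : WeierstrassCurve ℚ} [E'.IsElliptic]
    (χ : Isogeny W E')
    (hχ : ∀ Q, χ Q = 0 ↔ Q = 0 ∨ Q = W.toGeomPoints (.some x₀ 0 (nonsingular_of_root W hx₀))) :
    χ.IsBalanced ↔ IsSquare (W.a₄ + 2 * x₀ * W.a₂ + 3 * x₀ ^ 2) := by
  have h2 : (2 : ℚ) ≠ 0 := two_ne_zero
  have hW := ker_galoisRepTorsion_two_eq_top_of_roots W h2 h₂ h₄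
  have hdeg : χ.degree = 2 :=
    χ.degree_eq_two_of_ker_pair (toGeomPoints_some_ne_zero W (nonsingular_of_root W hx₀)) hχ
  constructor
  · intro hb
    exact isSquare_of_isogeny_ker_root h2 W hx₀ χ hχ (hb.2.symm.trans hW)
  · rintro ⟨δ, hδ⟩
    refine ⟨hdeg, hW.trans ?_⟩
    -- `E' ≅ B = E/⟨(x₀, 0)⟩`, which splits
    obtain ⟨hB, g, f, hgker, -, hgf⟩ := exists_isogeny_twoIsogenyCodomain_smul W hx₀
    haveI := hB
    obtain ⟨lam, hlam⟩ := Isogeny.exists_factor_of_ker_le h2 g f hgf χ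
      (fun P hP ↦ (hχ P).mpr ((hgker P).mp hP))
    have hinj := Isogeny.injective_of_factor g χ lam hlam
      (fun P hP ↦ (hgker P).mpr ((hχ P).mp hP))
    have hsurj := Isogeny.surjective_of_factor g χ lam hlam
    have hB2 := ker_galoisRepTorsion_two_eq_top_of_roots
      (((⟨1, x₀, 0, 0⟩ : VariableChange ℚ) • W).twoIsogenyCodomain) h2
      (r := (W.a₂ + 3 * x₀) + 2 * δ) (s := (W.a₂ + 3 * x₀) - 2 * δ)
      (by rw [twoIsogenyCodomain_a₂, smul_root_a₂]; ring)
      (by rw [twoIsogenyCodomain_a₄, smul_root_a₂, smul_root_a₄]; linear_combination -4 * hδ)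
    exact (ker_galoisRepTorsion_eq_top_of_bijective lam ⟨hinj, hsurj⟩ 2 hB2).symm

/-- **Existence of the balanced `2`-quotient** of `E : y² = x(x - r)(x - s)` by `(x₀, 0)` when
`b' = b + 2ax₀ + 3x₀²` is a square: the explicit quotient of
`exists_isogeny_twoIsogenyCodomain_smul` is then balanced. [cite: arXiv250317619, Def. 1.6] -/
theorem exists_isBalanced_of_isSquare (W : WeierstrassCurve ℚ) [W.IsTwoTorsionNF] [W.IsElliptic]
    {r s : ℚ} (h₂ : W.a₂ = -(r + s)) (h₄ : W.a₄ = r * s) {x₀ : ℚ}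
    (hx₀ : x₀ ^ 3 + W.a₂ * x₀ ^ 2 + W.a₄ * x₀ = 0)
    (hsq : IsSquare (W.a₄ + 2 * x₀ * W.a₂ + 3 * x₀ ^ 2)) :
    ∃ (W₀ : WeierstrassCurve ℚ) (_ : W₀.IsElliptic) (φ : Isogeny W W₀), φ.IsBalanced ∧
      ∀ Q, φ Q = 0 ↔ Q = 0 ∨ Q = W.toGeomPoints (.some x₀ 0 (nonsingular_of_root W hx₀)) := by
  obtain ⟨hB, g, -, hgker, -, -⟩ := exists_isogeny_twoIsogenyCodomain_smul W hx₀
  exact ⟨_, hB, g, (Isogeny.isBalanced_iff_isSquare_of_ker_root W h₂ h₄ hx₀ g hgker).mpr hsq, hgker⟩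

/-- **Every balanced isogeny on `E : y² = x(x - r)(x - s)` has kernel `{O, (x₀, 0)}` with
`x₀ ∈ {0, r, s}` and `b + 2ax₀ + 3x₀²` a square.** [cite: arXiv250317619, Def. 1.6] -/
theorem Isogeny.IsBalanced.exists_root (W : WeierstrassCurve ℚ) [W.IsTwoTorsionNF] [W.IsElliptic]
    {r s : ℚ} (h₂ : W.a₂ = -(r + s)) (h₄ : W.a₄ = r * s) {E' : WeierstrassCurve ℚ} [E'.IsElliptic]
    {χ : Isogeny W E'} (hχ : χ.IsBalanced) :
    ∃ (x₀ : ℚ) (hx₀ : x₀ ^ 3 + W.a₂ * x₀ ^ 2 + W.a₄ * x₀ = 0), (x₀ = 0 ∨ x₀ = r ∨ x₀ = s) ∧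
      IsSquare (W.a₄ + 2 * x₀ * W.a₂ + 3 * x₀ ^ 2) ∧
      ∀ Q, χ Q = 0 ↔ Q = 0 ∨ Q = W.toGeomPoints (.some x₀ 0 (nonsingular_of_root W hx₀)) := by
  obtain ⟨x₀, hx₀, hmem, hker⟩ := χ.exists_root_of_degree_eq_two W two_ne_zero h₂ h₄ hχ.1
  exact ⟨x₀, hx₀, hmem, (Isogeny.isBalanced_iff_isSquare_of_ker_root W h₂ h₄ hx₀ χ hker).mp hχ, hker⟩

end WeierstrassCurve

/-! ## §3 Smith's cases for `y² = x(x - r)(x - s)` and their non-vacuity -/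

namespace Literature.NumberTheory.EllipticCurves

open WeierstrassCurve

section Classification

variable (W : WeierstrassCurve ℚ) [W.IsTwoTorsionNF] [W.IsElliptic] {r s : ℚ}
  (h₂ : W.a₂ = -(r + s)) (h₄ : W.a₄ = r * s)

include h₂ h₄

/-- The three values `b + 2ax₀ + 3x₀²` at `x₀ = 0, r, s` are `rs`, `r(r - s)`, `s(s - r)`.
[folklore] -/
theorem isSquare_root_value_iff {x₀ : ℚ} (hmem : x₀ = 0 ∨ x₀ = r ∨ x₀ = s) :
    IsSquare (W.a₄ + 2 * x₀ * W.a₂ + 3 * x₀ ^ 2) ↔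
      (x₀ = 0 ∧ IsSquare (r * s)) ∨ (x₀ = r ∧ IsSquare (r * (r - s))) ∨
        (x₀ = s ∧ IsSquare (s * (s - r))) := by
  have hrs0 : r * s ≠ 0 := h₄ ▸ a₄_ne_zero W
  have hr : r ≠ 0 := left_ne_zero_of_mul hrs0
  have hs : s ≠ 0 := right_ne_zero_of_mul hrs0
  rcases hmem with rfl | rfl | rfl
  · rw [h₂, h₄]
    constructor
    · intro h; exact Or.inl ⟨rfl, by convert h using 1; ring⟩
    · rintro (⟨-, h⟩ | ⟨h, -⟩ | ⟨h, -⟩)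
      · convert h using 1; ring
      · exact absurd h.symm hr
      · exact absurd h.symm hs
  · rw [h₂, h₄]
    constructor
    · intro h; exact Or.inr (Or.inl ⟨rfl, by convert h using 1; ring⟩)
    · rintro (⟨h, -⟩ | ⟨-, h⟩ | ⟨h, h'⟩)
      · exact absurd h hr
      · convert h using 1; ring
      · rw [← h]; convert h' using 1; rw [← h]; ring
  · rw [h₂, h₄]
    constructor
    · intro h; exact Or.inr (Or.inr ⟨rfl, by convert h using 1; ring⟩)
    · rintro (⟨h, -⟩ | ⟨h, h'⟩ | ⟨-, h⟩)
      · exact absurd h hs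
      · rw [← h]; convert h' using 1; rw [← h]; ring
      · convert h using 1; ring

/-- **Case V in coordinates.** `E : y² = x(x - r)(x - s)` is in Smith's Case V iff (at least) two
of `rs`, `r(r - s)`, `s(s - r)` are squares in `ℚ`. [cite: arXiv250317619, Def. 1.6] -/
theorem smithCaseV_iff_of_roots :
    smithCaseV W ↔ (IsSquare (r * s) ∧ IsSquare (r * (r - s))) ∨
      (IsSquare (r * s) ∧ IsSquare (s * (s - r))) ∨
        (IsSquare (r * (r - s)) ∧ IsSquare (s * (s - r))) := by
  have hr : r ^ 3 + W.a₂ * r ^ 2 + W.a₄ * r = 0 := by rw [h₂, h₄]; ring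
  have hs : s ^ 3 + W.a₂ * s ^ 2 + W.a₄ * s = 0 := by rw [h₂, h₄]; ring
  have h0 : (0 : ℚ) ^ 3 + W.a₂ * 0 ^ 2 + W.a₄ * 0 = 0 := by ring
  -- two balanced isogenies with the kernels at `x₀ ≠ x₁` give Case V
  have build : ∀ {x₀ x₁ : ℚ} (hx₀ : x₀ ^ 3 + W.a₂ * x₀ ^ 2 + W.a₄ * x₀ = 0)
      (hx₁ : x₁ ^ 3 + W.a₂ * x₁ ^ 2 + W.a₄ * x₁ = 0), x₀ ≠ x₁ →
      IsSquare (W.a₄ + 2 * x₀ * W.a₂ + 3 * x₀ ^ 2) →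
      IsSquare (W.a₄ + 2 * x₁ * W.a₂ + 3 * x₁ ^ 2) → smithCaseV W := by
    intro x₀ x₁ hx₀ hx₁ hne hq₀ hq₁
    obtain ⟨W₀, hW₀, φ₀, hb₀, hk₀⟩ := exists_isBalanced_of_isSquare W h₂ h₄ hx₀ hq₀
    obtain ⟨W₁, hW₁, φ₁, hb₁, hk₁⟩ := exists_isBalanced_of_isSquare W h₂ h₄ hx₁ hq₁
    refine ⟨W₀, W₁, hW₀, hW₁, φ₀, φ₁, hb₀, hb₁, fun hker ↦ hne ?_⟩
    have hmem : W.toGeomPoints (.some x₀ 0 (nonsingular_of_root W hx₀)) ∈ φ₁.toAddMonoidHom.ker := by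
      rw [← hker, AddMonoidHom.mem_ker, Isogeny.coe_toAddMonoidHom, hk₀]
      exact Or.inr rfl
    rw [AddMonoidHom.mem_ker, Isogeny.coe_toAddMonoidHom, hk₁] at hmem
    rcases hmem with h | h
    · exact absurd h (toGeomPoints_some_ne_zero W _)
    · exact ((Affine.Point.some.injEq _ _ _ _ _ _).mp (toGeomPoints_injective W h)).1
  constructor
  · rintro ⟨W₁, W₂, _, _, φ₁, φ₂, hb₁, hb₂, hne⟩
    obtain ⟨x₁, hx₁, hm₁, hq₁, hk₁⟩ := hb₁.exists_root W h₂ h₄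
    obtain ⟨x₂, hx₂, hm₂, hq₂, hk₂⟩ := hb₂.exists_root W h₂ h₄
    have hne' : x₁ ≠ x₂ := by
      rintro rfl
      apply hne
      ext Q
      rw [AddMonoidHom.mem_ker, AddMonoidHom.mem_ker, Isogeny.coe_toAddMonoidHom,
        Isogeny.coe_toAddMonoidHom, hk₁ Q, hk₂ Q]
    rw [isSquare_root_value_iff W h₂ h₄ hm₁] at hq₁
    rw [isSquare_root_value_iff W h₂ h₄ hm₂] at hq₂
    rcases hq₁ with ⟨e₁, q₁⟩ | ⟨e₁, q₁⟩ | ⟨e₁, q₁⟩ <;>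
      rcases hq₂ with ⟨e₂, q₂⟩ | ⟨e₂, q₂⟩ | ⟨e₂, q₂⟩
    · exact absurd (e₁.trans e₂.symm) hne'
    · exact Or.inl ⟨q₁, q₂⟩
    · exact Or.inr (Or.inl ⟨q₁, q₂⟩)
    · exact Or.inl ⟨q₂, q₁⟩
    · exact absurd (e₁.trans e₂.symm) hne'
    · exact Or.inr (Or.inr ⟨q₁, q₂⟩)
    · exact Or.inr (Or.inl ⟨q₂, q₁⟩)
    · exact Or.inr (Or.inr ⟨q₂, q₁⟩)
    · exact absurd (e₁.trans e₂.symm) hne'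
  · have hrs0 : r * s ≠ 0 := h₄ ▸ a₄_ne_zero W
    have hr0 : r ≠ 0 := left_ne_zero_of_mul hrs0
    have hs0 : s ≠ 0 := right_ne_zero_of_mul hrs0
    have hrs : r ≠ s := by
      intro e
      apply a₂_sq_sub_ne_zero W
      rw [h₂, h₄, e]
      ring
    have v0 : IsSquare (r * s) → IsSquare (W.a₄ + 2 * 0 * W.a₂ + 3 * 0 ^ 2) := fun h ↦
      (isSquare_root_value_iff W h₂ h₄ (Or.inl rfl)).mpr (Or.inl ⟨rfl, h⟩)
    have vr : IsSquare (r * (r - s)) → IsSquare (W.a₄ + 2 * r * W.a₂ + 3 * r ^ 2) := fun h ↦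
      (isSquare_root_value_iff W h₂ h₄ (Or.inr (Or.inl rfl))).mpr (Or.inr (Or.inl ⟨rfl, h⟩))
    have vs : IsSquare (s * (s - r)) → IsSquare (W.a₄ + 2 * s * W.a₂ + 3 * s ^ 2) := fun h ↦
      (isSquare_root_value_iff W h₂ h₄ (Or.inr (Or.inr rfl))).mpr (Or.inr (Or.inr ⟨rfl, h⟩))
    rintro (⟨p, q⟩ | ⟨p, q⟩ | ⟨p, q⟩)
    · exact build h0 hr hr0.symm (v0 p) (vr q)
    · exact build h0 hs hs0.symm (v0 p) (vs q)
    · exact build hr hs hrs (vr p) (vs q)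

/-- **Case I in coordinates** (full `2`-torsion branch). `E : y² = x(x - r)(x - s)` is in
Smith's Case I iff none of `rs`, `r(r - s)`, `s(s - r)` is a square in `ℚ` (it has
`E(ℚ)[2] ≅ (ℤ/2ℤ)²` and then no balanced isogeny). [cite: arXiv250317619, Def. 1.6] -/
theorem smithCaseI_iff_of_roots :
    smithCaseI W ↔ ¬ IsSquare (r * s) ∧ ¬ IsSquare (r * (r - s)) ∧ ¬ IsSquare (s * (s - r)) := by
  have hr : r ^ 3 + W.a₂ * r ^ 2 + W.a₄ * r = 0 := by rw [h₂, h₄]; ring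
  have hs : s ^ 3 + W.a₂ * s ^ 2 + W.a₄ * s = 0 := by rw [h₂, h₄]; ring
  have h0 : (0 : ℚ) ^ 3 + W.a₂ * 0 ^ 2 + W.a₄ * 0 = 0 := by ring
  have h4 : ratTwoTorsionCard W = 4 := ratTwoTorsionCard_eq_four_of_ker_eq_top W
    (ker_galoisRepTorsion_two_eq_top_of_roots W two_ne_zero h₂ h₄)
  have noBal : ∀ {x₀ : ℚ} (hx₀ : x₀ ^ 3 + W.a₂ * x₀ ^ 2 + W.a₄ * x₀ = 0),
      IsSquare (W.a₄ + 2 * x₀ * W.a₂ + 3 * x₀ ^ 2) →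
      ¬ ∀ (W₀ : WeierstrassCurve ℚ) [W₀.IsElliptic] (φ : Isogeny W W₀), ¬ φ.IsBalanced := by
    intro x₀ hx₀ hq hall
    obtain ⟨W₀, hW₀, φ, hb, -⟩ := exists_isBalanced_of_isSquare W h₂ h₄ hx₀ hq
    exact hall W₀ φ hb
  constructor
  · rintro (h1 | ⟨-, hall⟩)
    · rw [h4] at h1; exact absurd h1 (by decide)
    · refine ⟨fun h ↦ noBal h0 ?_ hall, fun h ↦ noBal hr ?_ hall, fun h ↦ noBal hs ?_ hall⟩
      · exact (isSquare_root_value_iff W h₂ h₄ (Or.inl rfl)).mpr (Or.inl ⟨rfl, h⟩)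
      · exact (isSquare_root_value_iff W h₂ h₄ (Or.inr (Or.inl rfl))).mpr (Or.inr (Or.inl ⟨rfl, h⟩))
      · exact (isSquare_root_value_iff W h₂ h₄ (Or.inr (Or.inr rfl))).mpr (Or.inr (Or.inr ⟨rfl, h⟩))
  · rintro ⟨n0, nr, ns⟩
    refine Or.inr ⟨h4, fun W₀ _ φ hb ↦ ?_⟩
    obtain ⟨x₀, hx₀, hm, hq, -⟩ := hb.exists_root W h₂ h₄
    rcases (isSquare_root_value_iff W h₂ h₄ hm).mp hq with ⟨-, h⟩ | ⟨-, h⟩ | ⟨-, h⟩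
    · exact n0 h
    · exact nr h
    · exact ns h

/-- **Case IV in coordinates.** `E : y² = x(x - r)(x - s)` is in Smith's Case IV iff exactly one
of `rs`, `r(r - s)`, `s(s - r)` is a square in `ℚ`. [cite: arXiv250317619, Def. 1.6] -/
theorem smithCaseIV_iff_of_roots :
    smithCaseIV W ↔ (IsSquare (r * s) ∨ IsSquare (r * (r - s)) ∨ IsSquare (s * (s - r))) ∧
      ¬ ((IsSquare (r * s) ∧ IsSquare (r * (r - s))) ∨ (IsSquare (r * s) ∧ IsSquare (s * (s - r))) ∨
        (IsSquare (r * (r - s)) ∧ IsSquare (s * (s - r)))) := by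
  have hr : r ^ 3 + W.a₂ * r ^ 2 + W.a₄ * r = 0 := by rw [h₂, h₄]; ring
  have hs : s ^ 3 + W.a₂ * s ^ 2 + W.a₄ * s = 0 := by rw [h₂, h₄]; ring
  have h0 : (0 : ℚ) ^ 3 + W.a₂ * 0 ^ 2 + W.a₄ * 0 = 0 := by ring
  rw [← smithCaseV_iff_of_roots W h₂ h₄]
  constructor
  · intro hIV
    refine ⟨?_, not_smithCaseV_of_smithCaseIV hIV⟩
    obtain ⟨W₀, _, φ, hb⟩ := hIV.1
    obtain ⟨x₀, hx₀, hm, hq, -⟩ := hb.exists_root W h₂ h₄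
    rcases (isSquare_root_value_iff W h₂ h₄ hm).mp hq with ⟨-, h⟩ | ⟨-, h⟩ | ⟨-, h⟩
    · exact Or.inl h
    · exact Or.inr (Or.inl h)
    · exact Or.inr (Or.inr h)
  · rintro ⟨hsome, hnotV⟩
    obtain ⟨x₀, hx₀, hq⟩ : ∃ (x₀ : ℚ) (hx₀ : x₀ ^ 3 + W.a₂ * x₀ ^ 2 + W.a₄ * x₀ = 0),
        IsSquare (W.a₄ + 2 * x₀ * W.a₂ + 3 * x₀ ^ 2) := by
      rcases hsome with h | h | h
      · exact ⟨0, h0, (isSquare_root_value_iff W h₂ h₄ (Or.inl rfl)).mpr (Or.inl ⟨rfl, h⟩)⟩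
      · exact ⟨r, hr, (isSquare_root_value_iff W h₂ h₄ (Or.inr (Or.inl rfl))).mpr
          (Or.inr (Or.inl ⟨rfl, h⟩))⟩
      · exact ⟨s, hs, (isSquare_root_value_iff W h₂ h₄ (Or.inr (Or.inr rfl))).mpr
          (Or.inr (Or.inr ⟨rfl, h⟩))⟩
    obtain ⟨W₀, hW₀, φ, hb, -⟩ := exists_isBalanced_of_isSquare W h₂ h₄ hx₀ hq
    haveI := hW₀
    exact (smithCaseIV_or_smithCaseV_of_isBalanced φ hb).resolve_right hnotV

omit [W.IsTwoTorsionNF] [W.IsElliptic] h₂ h₄ in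
/-- **At most two of `rs`, `r(r - s)`, `s(s - r)` are squares** (`r, s ≠ 0` distinct): their
product is `-(rs(r - s))² < 0`. So a curve with full rational `2`-torsion has at most two balanced
kernels (the `2`-isogeny graph has no vertex of degree `3` all of whose neighbours have degree
`3`). [folklore] -/
theorem not_isSquare_three (hr : r ≠ 0) (hs : s ≠ 0) (hrs : r ≠ s) :
    ¬ (IsSquare (r * s) ∧ IsSquare (r * (r - s)) ∧ IsSquare (s * (s - r))) := by
  rintro ⟨⟨a, ha⟩, ⟨b, hb⟩, ⟨c, hc⟩⟩
  have hprod : (a * b * c) ^ 2 + (r * s * (r - s)) ^ 2 = 0 := by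
    have : (a * a) * (b * b) * (c * c) = -(r * s * (r - s)) ^ 2 := by rw [← ha, ← hb, ← hc]; ring
    linear_combination this
  have h0 : r * s * (r - s) ≠ 0 := mul_ne_zero (mul_ne_zero hr hs) (sub_ne_zero.mpr hrs)
  nlinarith [sq_nonneg (a * b * c), pow_pos (sq_pos_of_ne_zero h0) 1]

end Classification

/-! ### Non-vacuity: explicit curves in Cases I, III, IV, V -/

/-- `y² = x³ - 34x² + 225x = x(x - 25)(x - 9)` is elliptic. [folklore] -/
theorem isElliptic_caseV_example : (⟨0, -34, 0, 225, 0⟩ : WeierstrassCurve ℚ).IsElliptic :=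
  ⟨isUnit_iff_ne_zero.mpr (by norm_num [WeierstrassCurve.Δ, WeierstrassCurve.b₂,
    WeierstrassCurve.b₄, WeierstrassCurve.b₆, WeierstrassCurve.b₈])⟩

/-- **Case V is inhabited**: `y² = x(x - 25)(x - 9)` (`rs = 15²`, `r(r - s) = 20²`) is in Smith's
Case V. [cite: arXiv250317619, Def. 1.6] -/
theorem smithCaseV_example : smithCaseV (⟨0, -34, 0, 225, 0⟩ : WeierstrassCurve ℚ) := by
  haveI := isElliptic_caseV_example
  exact (smithCaseV_iff_of_roots (r := 25) (s := 9) _ (by norm_num) (by norm_num)).mpr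
    (Or.inl ⟨⟨15, by norm_num⟩, ⟨20, by norm_num⟩⟩)

/-- `y² = x³ - 5x² + 4x = x(x - 1)(x - 4)` is elliptic. [folklore] -/
theorem isElliptic_caseIV_example : (⟨0, -5, 0, 4, 0⟩ : WeierstrassCurve ℚ).IsElliptic :=
  ⟨isUnit_iff_ne_zero.mpr (by norm_num [WeierstrassCurve.Δ, WeierstrassCurve.b₂,
    WeierstrassCurve.b₄, WeierstrassCurve.b₆, WeierstrassCurve.b₈])⟩

/-- **Case IV is inhabited**: `y² = x(x - 1)(x - 4)` (`rs = 2²`, `r(r - s) = -3`, `s(s - r) = 12`,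
the last two no squares — `norm_num` decides `IsSquare` on rational literals) is in Smith's
Case IV. [cite: arXiv250317619, Def. 1.6] -/
theorem smithCaseIV_example : smithCaseIV (⟨0, -5, 0, 4, 0⟩ : WeierstrassCurve ℚ) := by
  haveI := isElliptic_caseIV_example
  refine (smithCaseIV_iff_of_roots (r := 1) (s := 4) _ (by norm_num) (by norm_num)).mpr ⟨?_, ?_⟩
  · exact Or.inl ⟨2, by norm_num⟩
  · have h3 : ¬ IsSquare ((1 : ℚ) * (1 - 4)) := by norm_num
    have h12 : ¬ IsSquare ((4 : ℚ) * (4 - 1)) := by norm_num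
    rintro (⟨-, h⟩ | ⟨-, h⟩ | ⟨h, -⟩)
    · exact h3 h
    · exact h12 h
    · exact h3 h

/-- The congruent number curve `y² = x³ - x = x(x - 1)(x + 1)` is elliptic. [folklore] -/
theorem isElliptic_caseI_example : (⟨0, 0, 0, -1, 0⟩ : WeierstrassCurve ℚ).IsElliptic :=
  ⟨isUnit_iff_ne_zero.mpr (by norm_num [WeierstrassCurve.Δ, WeierstrassCurve.b₂,
    WeierstrassCurve.b₄, WeierstrassCurve.b₆, WeierstrassCurve.b₈])⟩

/-- **Case I (full `2`-torsion branch) is inhabited**: the congruent number curve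
`y² = x³ - x = x(x - 1)(x + 1)` (`rs = -1`, `r(r - s) = s(s - r) = 2`) has
`E(ℚ)[2] ≅ (ℤ/2ℤ)²` and no balanced isogeny (its `2`-isogeny graph is `T₄`).
[cite: arXiv250317619, Def. 1.6] -/
theorem smithCaseI_example : smithCaseI (⟨0, 0, 0, -1, 0⟩ : WeierstrassCurve ℚ) := by
  haveI := isElliptic_caseI_example
  refine (smithCaseI_iff_of_roots (r := 1) (s := -1) _ (by norm_num) (by norm_num)).mpr
    ⟨?_, ?_, ?_⟩
  · norm_num
  · norm_num
  · norm_num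

/-- `y² = x³ + 4x` is elliptic. [folklore] -/
theorem isElliptic_caseIII_example : (⟨0, 0, 0, 4, 0⟩ : WeierstrassCurve ℚ).IsElliptic :=
  ⟨isUnit_iff_ne_zero.mpr (by norm_num [WeierstrassCurve.Δ, WeierstrassCurve.b₂,
    WeierstrassCurve.b₄, WeierstrassCurve.b₆, WeierstrassCurve.b₈])⟩

/-- **Case III is inhabited**: `E : y² = x³ + 4x` has `E(ℚ)[2] ≅ ℤ/2ℤ` (`x² + 4` has no rational
root: `#E(ℚ)[2] ≠ 4` as `ℚ(E[2]) = ℚ` would split it, and `≠ 1` as `(0,0)` spans a degree-`2`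
isogeny), and its `2`-quotient `Y² = X³ - 16X = X(X - 4)(X + 4)` has full rational `2`-torsion.
[cite: arXiv250317619, Def. 1.6] -/
theorem smithCaseIII_example : smithCaseIII (⟨0, 0, 0, 4, 0⟩ : WeierstrassCurve ℚ) := by
  haveI := isElliptic_caseIII_example
  have ha₂ : (⟨0, 0, 0, 4, 0⟩ : WeierstrassCurve ℚ).a₂ = 0 := rfl
  have ha₄ : (⟨0, 0, 0, 4, 0⟩ : WeierstrassCurve ℚ).a₄ = 4 := rfl
  have hdeg : ((⟨0, 0, 0, 4, 0⟩ : WeierstrassCurve ℚ).twoIsogeny).degree = 2 := degree_twoIsogeny _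
  refine ⟨?_, _, inferInstance, (⟨0, 0, 0, 4, 0⟩ : WeierstrassCurve ℚ).twoIsogeny, hdeg, ?_⟩
  · rcases ratTwoTorsionCard_eq_one_or_two_or_four (⟨0, 0, 0, 4, 0⟩ : WeierstrassCurve ℚ) with
      h1 | h2 | h4
    · exact absurd h1 (Isogeny.ratTwoTorsionCard_ne_one_of_degree_eq_two _ _ hdeg)
    · exact h2
    · exfalso
      obtain ⟨α, β, hα, hβ⟩ := exists_roots_of_ker_galoisRepTorsion_two_eq_top _ two_ne_zero
        (ker_galoisRepTorsion_two_eq_top_of_ratTwoTorsionCard_eq_four _ h4)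
      rw [ha₂] at hα
      rw [ha₄] at hβ
      have hαβ : α = -β := by linarith
      rw [hαβ] at hβ
      nlinarith [mul_self_nonneg β]
  · exact ratTwoTorsionCard_eq_four_of_ker_eq_top _
      (ker_galoisRepTorsion_two_eq_top_of_roots _ two_ne_zero (r := 4) (s := -4)
        (by rw [twoIsogenyCodomain_a₂, ha₂]; norm_num) (by rw [twoIsogenyCodomain_a₄, ha₂, ha₄]; norm_num))

/-- `y² = x³ + 2x` is elliptic. [folklore] -/
theorem isElliptic_caseII_example : (⟨0, 0, 0, 2, 0⟩ : WeierstrassCurve ℚ).IsElliptic :=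
  ⟨isUnit_iff_ne_zero.mpr (by norm_num [WeierstrassCurve.Δ, WeierstrassCurve.b₂,
    WeierstrassCurve.b₄, WeierstrassCurve.b₆, WeierstrassCurve.b₈])⟩

/-- On `E : y² = x³ + bx` over `ℚ` with `b = -w²` in `ℚ̄`, `σ ∈ Γ_ℚ` fixes `E[2]` pointwise iff
`σ w = w` (`E[2] = {O, (0,0), (±w, 0)}`). [folklore] -/
theorem mem_ker_galoisRepTorsion_two_iff_of_sq (E : WeierstrassCurve ℚ) [E.IsTwoTorsionNF]
    [E.IsElliptic] (ha₂ : E.a₂ = 0) {w : AlgebraicClosure ℚ}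
    (hw : (algebraMap ℚ (AlgebraicClosure ℚ)) E.a₄ = -(w * w)) (σ : Field.absoluteGaloisGroup ℚ) :
    σ ∈ (E.galoisRepTorsion 2).ker ↔
      (show AlgebraicClosure ℚ ≃ₐ[ℚ] AlgebraicClosure ℚ from σ) w = w := by
  have h2L : (2 : AlgebraicClosure ℚ) ≠ 0 := two_ne_zero
  have h₂ : (E.baseChange (AlgebraicClosure ℚ)).a₂ = -(w + -w) := by
    rw [baseChange, map_a₂, ha₂, map_zero]; ring
  have h₄ : (E.baseChange (AlgebraicClosure ℚ)).a₄ = w * -w := by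
    rw [baseChange, map_a₄, hw]; ring
  have hwroot : w ^ 3 + (E.baseChange (AlgebraicClosure ℚ)).a₂ * w ^ 2 +
      (E.baseChange (AlgebraicClosure ℚ)).a₄ * w = 0 := by
    rw [h₂, h₄]; ring
  have hns := nonsingular_of_root (E.baseChange (AlgebraicClosure ℚ)) hwroot
  rw [mem_ker_galoisRepTorsion_iff']
  constructor
  · intro h
    have hP2 : (2 : ℤ) • (Affine.Point.some w 0 hns : E.geomPoints) = 0 := by
      have h1 : (2 : ℕ) • (Affine.Point.some w 0 hns) = 0 :=
        (two_nsmul_some_eq_zero_iff (E.baseChange (AlgebraicClosure ℚ)) h2L hns).mpr rfl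
      exact_mod_cast h1
    have hσP := h _ hP2
    obtain ⟨h', e'⟩ := smul_eq_some_of_eq' E σ (rfl : (Affine.Point.some w 0 hns : E.geomPoints) = _)
    rw [e'] at hσP
    exact ((Affine.Point.some.injEq _ _ _ _ _ _).mp hσP).1
  · intro hσw P hP
    have hP' : (2 : ℕ) • P = 0 := by exact_mod_cast hP
    rcases eq_of_two_nsmul_eq_zero (E.baseChange (AlgebraicClosure ℚ)) h2L h₂ h₄
      (P := P) hP' with h0 | ⟨x, hx, hPx, hx0⟩
    · have h0' : P = (0 : E.geomPoints) := h0
      rw [h0']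
      exact smul_zero σ
    · obtain ⟨h', e'⟩ := smul_eq_some_of_eq' E σ hPx
      rw [e']
      have hσx : (show AlgebraicClosure ℚ ≃ₐ[ℚ] AlgebraicClosure ℚ from σ) x = x := by
        rcases hx0 with rfl | rfl | rfl
        · exact map_zero _
        · exact hσw
        · rw [map_neg, hσw]
      obtain ⟨h'', e''⟩ := some_eq_some_of_eq (V := E.baseChange (AlgebraicClosure ℚ)) h' hσx
        (map_zero _)
      have hPx' : P = (Affine.Point.some x 0 h'' : E.geomPoints) := hPx
      rw [hPx']
      exact e''

/-- **Case II is inhabited**: `E : y² = x³ + 2x` has `E(ℚ)[2] ≅ ℤ/2ℤ`, its `2`-isogeny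
`φ : E → E_0 : Y² = X³ - 8X` is not balanced (`ℚ(E[2]) = ℚ(√-2) ≠ ℚ(√2) = ℚ(E_0[2])`: if every
`σ ∈ Γ_ℚ` fixed `√-2` exactly when it fixes `√8`, then `√-2 · √8` would be fixed by `Γ_ℚ`, i.e.
`-16` would be a rational square), and `E_0(ℚ)[2] ≇ (ℤ/2ℤ)²`. [cite: arXiv250317619, Def. 1.6] -/
theorem smithCaseII_example : smithCaseII (⟨0, 0, 0, 2, 0⟩ : WeierstrassCurve ℚ) := by
  haveI := isElliptic_caseII_example
  have ha₂ : (⟨0, 0, 0, 2, 0⟩ : WeierstrassCurve ℚ).a₂ = 0 := rfl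
  have ha₄ : (⟨0, 0, 0, 2, 0⟩ : WeierstrassCurve ℚ).a₄ = 2 := rfl
  have hdeg : ((⟨0, 0, 0, 2, 0⟩ : WeierstrassCurve ℚ).twoIsogeny).degree = 2 := degree_twoIsogeny _
  have hb₂ : (⟨0, 0, 0, 2, 0⟩ : WeierstrassCurve ℚ).twoIsogenyCodomain.a₂ = 0 := by
    rw [twoIsogenyCodomain_a₂, ha₂]; ring
  have hb₄ : (⟨0, 0, 0, 2, 0⟩ : WeierstrassCurve ℚ).twoIsogenyCodomain.a₄ = -8 := by
    rw [twoIsogenyCodomain_a₄, ha₂, ha₄]; ring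
  refine ⟨?_, _, inferInstance, (⟨0, 0, 0, 2, 0⟩ : WeierstrassCurve ℚ).twoIsogeny, hdeg, ?_, ?_⟩
  · -- `#E(ℚ)[2] = 2`
    rcases ratTwoTorsionCard_eq_one_or_two_or_four (⟨0, 0, 0, 2, 0⟩ : WeierstrassCurve ℚ) with
      h1 | h2 | h4
    · exact absurd h1 (Isogeny.ratTwoTorsionCard_ne_one_of_degree_eq_two _ _ hdeg)
    · exact h2
    · exfalso
      obtain ⟨α, β, hα, hβ⟩ := exists_roots_of_ker_galoisRepTorsion_two_eq_top _ two_ne_zero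
        (ker_galoisRepTorsion_two_eq_top_of_ratTwoTorsionCard_eq_four _ h4)
      rw [ha₂] at hα
      rw [ha₄] at hβ
      have hαβ : α = -β := by linarith
      rw [hαβ] at hβ
      nlinarith [mul_self_nonneg β]
  · -- `φ` is not balanced
    intro hb
    -- square roots `w² = -2`, `u² = 8` in `ℚ̄`
    obtain ⟨w, hw⟩ := IsAlgClosed.exists_eq_mul_self (-2 : AlgebraicClosure ℚ)
    obtain ⟨u, hu⟩ := IsAlgClosed.exists_eq_mul_self (8 : AlgebraicClosure ℚ)
    have hw0 : w ≠ 0 := by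
      rintro rfl
      norm_num at hw
    have hE : ∀ σ : Field.absoluteGaloisGroup ℚ,
        σ ∈ ((⟨0, 0, 0, 2, 0⟩ : WeierstrassCurve ℚ).galoisRepTorsion 2).ker ↔
          (show AlgebraicClosure ℚ ≃ₐ[ℚ] AlgebraicClosure ℚ from σ) w = w :=
      mem_ker_galoisRepTorsion_two_iff_of_sq _ ha₂ (by rw [ha₄, ← hw]; norm_num)
    have hE₀ : ∀ σ : Field.absoluteGaloisGroup ℚ,
        σ ∈ ((⟨0, 0, 0, 2, 0⟩ : WeierstrassCurve ℚ).twoIsogenyCodomain.galoisRepTorsion 2).ker ↔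
          (show AlgebraicClosure ℚ ≃ₐ[ℚ] AlgebraicClosure ℚ from σ) u = u :=
      mem_ker_galoisRepTorsion_two_iff_of_sq _ hb₂ (by rw [hb₄, ← hu]; norm_num)
    -- `t = wu` is fixed by `Γ_ℚ`
    have hfix : ∀ σ : Field.absoluteGaloisGroup ℚ,
        (show AlgebraicClosure ℚ ≃ₐ[ℚ] AlgebraicClosure ℚ from σ) (w * u) = w * u := by
      intro σ
      have hiff : (show AlgebraicClosure ℚ ≃ₐ[ℚ] AlgebraicClosure ℚ from σ) w = w ↔
          (show AlgebraicClosure ℚ ≃ₐ[ℚ] AlgebraicClosure ℚ from σ) u = u := by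
        rw [← hE, ← hE₀, hb.2]
      have hσw : (show AlgebraicClosure ℚ ≃ₐ[ℚ] AlgebraicClosure ℚ from σ) w *
          (show AlgebraicClosure ℚ ≃ₐ[ℚ] AlgebraicClosure ℚ from σ) w = w * w := by
        rw [← map_mul, ← hw, map_neg, map_ofNat]
      have hσu : (show AlgebraicClosure ℚ ≃ₐ[ℚ] AlgebraicClosure ℚ from σ) u *
          (show AlgebraicClosure ℚ ≃ₐ[ℚ] AlgebraicClosure ℚ from σ) u = u * u := by
        rw [← map_mul, ← hu, map_ofNat]
      rw [map_mul]
      rcases mul_self_eq_mul_self_iff.mp hσw with h | h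
      · rw [h, hiff.mp h]
      · rcases mul_self_eq_mul_self_iff.mp hσu with h' | h'
        · have hww : w = -w := (hiff.mpr h').symm.trans h
          have h2w : (2 : AlgebraicClosure ℚ) * w = 0 := by linear_combination hww
          exact absurd ((mul_eq_zero.mp h2w).resolve_left two_ne_zero) hw0
        · rw [h, h']; ring
    -- hence `wu` is rational, with square `-16`
    haveI : IsGalois ℚ (AlgebraicClosure ℚ) :=
      @IsAlgClosure.isGalois ℚ (AlgebraicClosure ℚ) _ _ (AlgebraicClosure.instAlgebra ℚ) _ _
    obtain ⟨q, hq⟩ := (InfiniteGalois.mem_range_algebraMap_iff_fixed (w * u)).mpr hfix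
    rw [eq_ratCast] at hq
    have hq2 : ((q * q + 16 : ℚ) : AlgebraicClosure ℚ) = 0 := by
      push_cast
      rw [hq]
      linear_combination (-(u * u)) * hw + 2 * hu
    have : q * q + 16 = 0 := by exact_mod_cast hq2
    nlinarith [mul_self_nonneg q]
  · -- `#E_0(ℚ)[2] ≠ 4`
    intro h4
    obtain ⟨α, β, hα, hβ⟩ := exists_roots_of_ker_galoisRepTorsion_two_eq_top _ two_ne_zero
      (ker_galoisRepTorsion_two_eq_top_of_ratTwoTorsionCard_eq_four _ h4)
    rw [hb₂] at hα
    rw [hb₄] at hβ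
    have hαβ : α = -β := by linarith
    rw [hαβ] at hβ
    have h8 : IsSquare (8 : ℚ) := ⟨β, by linarith⟩
    norm_num at h8

end Literature.NumberTheory.EllipticCurves

end
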